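import Literature.NumberTheory.Sieve.SmoothSaddlePointUniform
import Literature.NumberTheory.Sieve.SmoothZetaLogDeriv
import HarnessLib

/-!
# The higher derivatives `φ₃(σ, y)`, `φ₄(σ, y)` of `log ζ(σ, y)` and their orders at the saddle point

Topic `Literature/NumberTheory/Sieve`; companion of `SmoothSaddlePointPhi.lean` (`saddlePhi₂ = φ₂`)
toward Hildebrand–Tenenbaum's saddle-point theorem [HildebrandTenenbaum1986, Thm 1], whose proof
(Lemma 8, Lemma 11, §6) uses the derivatives `φ_k(s, y) = (∂/∂s)^k log ζ(s, y)` for `k ≤ 4` and their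
orders at `s = α(x, y)`, Lemma 4 (3.8): `0 < (-1)^k φ_k(α, y) ≍ (u log y)^k ū^{1-k}` (`u = log x/log y`,
`ū = min(u, y/log y)`). Two DEFINITIONS with bodies (the positive quantities `-φ₃` and `φ₄` at a real
point, by (3.9): `(-1)^k φ_k(σ, y) = Σ_{p ≤ y} (log p)^k Q_{k-1}(p^σ) p^σ/(p^σ - 1)^k` with
`Q₁(w) = 1`, `Q₂(w) = w + 1`, `Q₃(w) = w² + 4w + 1`), everything else PROVED:

* `saddlePhi₃ σ y = Σ_{p ≤ y} log³ p · p^σ (p^σ + 1)/(p^σ - 1)³ = -φ₃(σ, y)`,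
  `saddlePhi₄ σ y = Σ_{p ≤ y} log⁴ p · p^σ (p^{2σ} + 4p^σ + 1)/(p^σ - 1)⁴ = φ₄(σ, y)`;
* `hasDerivAt_saddlePhi₂'` (`(d/dσ) φ₂ = φ₃ = -saddlePhi₃`), `hasDerivAt_saddlePhi₃`
  (`(d/dσ)(-φ₃) = -φ₄`), positivity;
* `saddlePhi₃_le_mul_saddlePhi₂`, `saddlePhi₄_le_mul_saddlePhi₂` — for `σ ≥ 3/5`:
  `-φ₃ ≤ 5 log y · φ₂`, `φ₄ ≤ 37 log² y · φ₂`;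
* `exists_saddlePhi₃_saddlePoint_le_uniform`, `exists_saddlePhi₄_saddlePoint_le_uniform` — the UPPER
  halves of Lemma 4 (3.8) for `k = 3, 4` over the whole range `x ≥ y ≥ y₀`:
  `-φ₃(α, y) ≪ log x log² y + (log x)³ log² y/y²`, `φ₄(α, y) ≪ log x log³ y + (log x)⁴ log³ y/y³`
  (same two regimes as `exists_saddlePhi₂_saddlePoint_le_uniform`: `α log y ≤ 1`, where
  `p^α - 1 ≥ α log p` and `p^α ≤ 3` termwise against `-φ₁(α, y) ≥ π(y)/(3α)`; and `α log y > 1`, split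
  at `p^α ≥ 5/4`).

* complex `s` (section `Complex`): `smoothPhi₃`, `smoothPhi₄` (closed forms as above, `_ofReal`),
  `hasDerivAt_smoothPhi₂` (`φ₂' = φ₃`), `hasDerivAt_smoothPhi₃`, the modulus bounds
  `norm_smoothPhi₃_le : |φ₃(σ+it, y)| ≤ -φ₃(σ, y)`, `norm_smoothPhi₄_le : |φ₄(σ+it, y)| ≤ φ₄(σ, y)` and the
  Lipschitz bounds `‖φ₂(σ+it) - φ₂(σ)‖ ≤ |t|(-φ₃(σ))`, `‖φ₃(σ+it) - φ₃(σ)‖ ≤ |t| φ₄(σ)`, valid for ALL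
  `σ > 0` (the tree's `norm_smoothPhi₂_sub_le` needs `σ ≥ 3/5`) — the Taylor-remainder tools for the
  saddle exponent `φ(α+it) - φ(α) + it log x = -φ₂t²/2 - iφ₃t³/6 + O(φ₄ t⁴)` of Lemma 11.

NOT here: the lower halves of (3.8) for `k = 3, 4` (not needed for Theorem 1).

## References

* [HildebrandTenenbaum1986] A. Hildebrand, G. Tenenbaum, Trans. AMS 296 (1986) 265–290, §2
  (definition of `φ_k`), Lemma 4 (3.8)–(3.9), §6 (held: `paper:doi-10-1090-s0002-9947-1986-0837811-1`,
  pp. 267, 273–274, 283–284).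
-/

noncomputable section

open Real Filter Finset MeasureTheory Chebyshev

namespace Literature.NumberTheory.Sieve

variable {σ : ℝ} {y p : ℕ}

/-! ### Definitions and positivity -/

/-- `-φ₃(σ, y) = Σ_{p ≤ y} log³ p · p^σ (p^σ + 1)/(p^σ - 1)³`, minus the third `σ`-derivative of
`log ζ(σ, y)` (positive for `σ > 0`); Hildebrand–Tenenbaum's `(-1)³ φ₃(σ, y)` in the form (3.9) with
`Q₂(w) = w + 1`. [cite: HildebrandTenenbaum1986, §2 (definition of φ_k) and Lemma 4 (3.9)] -/
def saddlePhi₃ (σ : ℝ) (y : ℕ) : ℝ :=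
  ∑ p ∈ Nat.primesLE y, Real.log p ^ 3 * ((p : ℝ) ^ σ * ((p : ℝ) ^ σ + 1) / ((p : ℝ) ^ σ - 1) ^ 3)

/-- `φ₄(σ, y) = Σ_{p ≤ y} log⁴ p · p^σ (p^{2σ} + 4 p^σ + 1)/(p^σ - 1)⁴`, the fourth `σ`-derivative of
`log ζ(σ, y)` (positive for `σ > 0`); Hildebrand–Tenenbaum's `(-1)⁴ φ₄(σ, y)` in the form (3.9) with
`Q₃(w) = w² + 4w + 1`. [cite: HildebrandTenenbaum1986, §2 (definition of φ_k) and Lemma 4 (3.9)] -/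
def saddlePhi₄ (σ : ℝ) (y : ℕ) : ℝ :=
  ∑ p ∈ Nat.primesLE y, Real.log p ^ 4 *
    ((p : ℝ) ^ σ * (((p : ℝ) ^ σ) ^ 2 + 4 * (p : ℝ) ^ σ + 1) / ((p : ℝ) ^ σ - 1) ^ 4)

/-- Unfolding lemma for `saddlePhi₃`. [folklore] -/
theorem saddlePhi₃_def (σ : ℝ) (y : ℕ) : saddlePhi₃ σ y =
    ∑ p ∈ Nat.primesLE y, Real.log p ^ 3 * ((p : ℝ) ^ σ * ((p : ℝ) ^ σ + 1) / ((p : ℝ) ^ σ - 1) ^ 3) :=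
  rfl

/-- Unfolding lemma for `saddlePhi₄`. [folklore] -/
theorem saddlePhi₄_def (σ : ℝ) (y : ℕ) : saddlePhi₄ σ y =
    ∑ p ∈ Nat.primesLE y, Real.log p ^ 4 *
      ((p : ℝ) ^ σ * (((p : ℝ) ^ σ) ^ 2 + 4 * (p : ℝ) ^ σ + 1) / ((p : ℝ) ^ σ - 1) ^ 4) := rfl

/-- Members of `primesLE y` are at least `2` (as reals). [folklore] -/
private theorem two_le_of_mem_primesLE (hp : p ∈ Nat.primesLE y) : (2 : ℝ) ≤ p := by
  exact_mod_cast (Nat.mem_primesLE.1 hp).2.two_le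

/-- The terms of `-φ₃` are positive for `σ > 0`. [folklore] -/
theorem saddlePhi₃_term_pos (hp : p ∈ Nat.primesLE y) (hσ : 0 < σ) :
    0 < Real.log p ^ 3 * ((p : ℝ) ^ σ * ((p : ℝ) ^ σ + 1) / ((p : ℝ) ^ σ - 1) ^ 3) := by
  have hp2 := two_le_of_mem_primesLE hp
  have hlog : 0 < Real.log p := Real.log_pos (by linarith)
  have hP : 1 < (p : ℝ) ^ σ := Real.one_lt_rpow (by linarith) hσ
  have : 0 < (p : ℝ) ^ σ - 1 := by linarith
  positivity

/-- The terms of `φ₄` are positive for `σ > 0`. [folklore] -/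
theorem saddlePhi₄_term_pos (hp : p ∈ Nat.primesLE y) (hσ : 0 < σ) :
    0 < Real.log p ^ 4 *
      ((p : ℝ) ^ σ * (((p : ℝ) ^ σ) ^ 2 + 4 * (p : ℝ) ^ σ + 1) / ((p : ℝ) ^ σ - 1) ^ 4) := by
  have hp2 := two_le_of_mem_primesLE hp
  have hlog : 0 < Real.log p := Real.log_pos (by linarith)
  have hP : 1 < (p : ℝ) ^ σ := Real.one_lt_rpow (by linarith) hσ
  have : 0 < (p : ℝ) ^ σ - 1 := by linarith
  positivity

/-- `-φ₃(σ, y) ≥ 0`. [folklore] -/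
theorem saddlePhi₃_nonneg (hσ : 0 < σ) (y : ℕ) : 0 ≤ saddlePhi₃ σ y :=
  Finset.sum_nonneg fun _ hp => (saddlePhi₃_term_pos hp hσ).le

/-- `φ₄(σ, y) ≥ 0`. [folklore] -/
theorem saddlePhi₄_nonneg (hσ : 0 < σ) (y : ℕ) : 0 ≤ saddlePhi₄ σ y :=
  Finset.sum_nonneg fun _ hp => (saddlePhi₄_term_pos hp hσ).le

/-- `-φ₃(σ, y) > 0` for `y ≥ 2`, `σ > 0`. [folklore] -/
theorem saddlePhi₃_pos (hy : 2 ≤ y) (hσ : 0 < σ) : 0 < saddlePhi₃ σ y := by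
  have h2 : 2 ∈ Nat.primesLE y := Nat.mem_primesLE.2 ⟨hy, Nat.prime_two⟩
  exact Finset.sum_pos' (fun _ hp => (saddlePhi₃_term_pos hp hσ).le) ⟨2, h2, saddlePhi₃_term_pos h2 hσ⟩

/-- `φ₄(σ, y) > 0` for `y ≥ 2`, `σ > 0`. [folklore] -/
theorem saddlePhi₄_pos (hy : 2 ≤ y) (hσ : 0 < σ) : 0 < saddlePhi₄ σ y := by
  have h2 : 2 ∈ Nat.primesLE y := Nat.mem_primesLE.2 ⟨hy, Nat.prime_two⟩
  exact Finset.sum_pos' (fun _ hp => (saddlePhi₄_term_pos hp hσ).le) ⟨2, h2, saddlePhi₄_term_pos h2 hσ⟩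

/-! ### `φ₂' = φ₃`, `φ₃' = φ₄` -/

/-- **`(d/dσ) φ₂(σ, y) = φ₃(σ, y) = -saddlePhi₃ σ y`** (`σ > 0`): termwise
`(d/dw)[w/(w-1)²] = -(w+1)/(w-1)³` at `w = p^σ`, `(d/dσ) p^σ = log p · p^σ`.
[cite: HildebrandTenenbaum1986, §2 (definition of φ_k)] -/
theorem hasDerivAt_saddlePhi₂' (hσ : 0 < σ) :
    HasDerivAt (fun s : ℝ => saddlePhi₂ s y) (-saddlePhi₃ σ y) σ := by
  have hterm : ∀ p ∈ Nat.primesLE y,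
      HasDerivAt (fun s : ℝ => Real.log p ^ 2 * ((p : ℝ) ^ s / ((p : ℝ) ^ s - 1) ^ 2))
        (-(Real.log p ^ 3 * ((p : ℝ) ^ σ * ((p : ℝ) ^ σ + 1) / ((p : ℝ) ^ σ - 1) ^ 3))) σ := by
    intro p hp
    have hp2 := two_le_of_mem_primesLE hp
    have hp0 : (0 : ℝ) < p := by linarith
    have hpσ : 1 < (p : ℝ) ^ σ := Real.one_lt_rpow (by linarith) hσ
    have hne : (p : ℝ) ^ σ - 1 ≠ 0 := by linarith
    have hne2 : ((p : ℝ) ^ σ - 1) ^ 2 ≠ 0 := pow_ne_zero 2 hne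
    have h1 : HasDerivAt (fun s : ℝ => (p : ℝ) ^ s) (Real.log p * 1 * (p : ℝ) ^ σ) σ :=
      (hasDerivAt_id σ).const_rpow hp0
    have h2 : HasDerivAt (fun s : ℝ => ((p : ℝ) ^ s - 1) ^ 2)
        ((2 : ℕ) * ((p : ℝ) ^ σ - 1) ^ (2 - 1) * (Real.log p * 1 * (p : ℝ) ^ σ)) σ :=
      (h1.sub_const 1).pow 2
    have h3 := ((h1.div h2 hne2).const_mul (Real.log p ^ 2))
    refine h3.congr_deriv ?_
    field_simp
    push_cast
    ring
  have h := HasDerivAt.fun_sum hterm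
  simp only [Finset.sum_neg_distrib] at h
  rw [saddlePhi₃_def]
  exact h.congr_of_eventuallyEq (Eventually.of_forall fun s => rfl)

/-- **`(d/dσ)(-φ₃(σ, y)) = -φ₄(σ, y)`** (`σ > 0`): termwise
`(d/dw)[w(w+1)/(w-1)³] = -(w² + 4w + 1)/(w-1)⁴` at `w = p^σ`.
[cite: HildebrandTenenbaum1986, §2 (definition of φ_k)] -/
theorem hasDerivAt_saddlePhi₃ (hσ : 0 < σ) :
    HasDerivAt (fun s : ℝ => saddlePhi₃ s y) (-saddlePhi₄ σ y) σ := by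
  have hterm : ∀ p ∈ Nat.primesLE y,
      HasDerivAt (fun s : ℝ => Real.log p ^ 3 * ((p : ℝ) ^ s * ((p : ℝ) ^ s + 1) / ((p : ℝ) ^ s - 1) ^ 3))
        (-(Real.log p ^ 4 * ((p : ℝ) ^ σ * (((p : ℝ) ^ σ) ^ 2 + 4 * (p : ℝ) ^ σ + 1) /
          ((p : ℝ) ^ σ - 1) ^ 4))) σ := by
    intro p hp
    have hp2 := two_le_of_mem_primesLE hp
    have hp0 : (0 : ℝ) < p := by linarith
    have hpσ : 1 < (p : ℝ) ^ σ := Real.one_lt_rpow (by linarith) hσ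
    have hne : (p : ℝ) ^ σ - 1 ≠ 0 := by linarith
    have hne3 : ((p : ℝ) ^ σ - 1) ^ 3 ≠ 0 := pow_ne_zero 3 hne
    have h1 : HasDerivAt (fun s : ℝ => (p : ℝ) ^ s) (Real.log p * 1 * (p : ℝ) ^ σ) σ :=
      (hasDerivAt_id σ).const_rpow hp0
    have hnum : HasDerivAt (fun s : ℝ => (p : ℝ) ^ s * ((p : ℝ) ^ s + 1))
        (Real.log p * 1 * (p : ℝ) ^ σ * ((p : ℝ) ^ σ + 1) +
          (p : ℝ) ^ σ * (Real.log p * 1 * (p : ℝ) ^ σ)) σ := h1.mul (h1.add_const 1)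
    have hden : HasDerivAt (fun s : ℝ => ((p : ℝ) ^ s - 1) ^ 3)
        ((3 : ℕ) * ((p : ℝ) ^ σ - 1) ^ (3 - 1) * (Real.log p * 1 * (p : ℝ) ^ σ)) σ :=
      (h1.sub_const 1).pow 3
    have h3 := ((hnum.div hden hne3).const_mul (Real.log p ^ 3))
    refine h3.congr_deriv ?_
    field_simp
    push_cast
    ring
  have h := HasDerivAt.fun_sum hterm
  simp only [Finset.sum_neg_distrib] at h
  rw [saddlePhi₄_def]
  exact h.congr_of_eventuallyEq (Eventually.of_forall fun s => rfl)

/-! ### Elementary comparisons for `σ ≥ 3/5` -/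

/-- For `σ ≥ 3/5` and a prime `p`: `p^σ ≥ 3/2`. [folklore] -/
theorem three_halves_le_rpow (hp : p ∈ Nat.primesLE y) (hσ : 3 / 5 ≤ σ) : (3 / 2 : ℝ) ≤ (p : ℝ) ^ σ := by
  have hp2 := two_le_of_mem_primesLE hp
  calc (3 / 2 : ℝ) ≤ (2 : ℝ) ^ (3 / 5 : ℝ) := three_halves_le_two_rpow
    _ ≤ (2 : ℝ) ^ σ := Real.rpow_le_rpow_of_exponent_le one_le_two hσ
    _ ≤ (p : ℝ) ^ σ := Real.rpow_le_rpow (by norm_num) hp2 (by linarith)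

/-- **`-φ₃(σ, y) ≤ 5 log y · φ₂(σ, y)`** for `σ ≥ 3/5` (termwise `log p ≤ log y` and
`(p^σ + 1)/(p^σ - 1) ≤ 5` as `p^σ ≥ 3/2`). [cite: HildebrandTenenbaum1986, Lemma 4 (3.8), proof] -/
theorem saddlePhi₃_le_mul_saddlePhi₂ (hσ : 3 / 5 ≤ σ) (y : ℕ) :
    saddlePhi₃ σ y ≤ 5 * Real.log y * saddlePhi₂ σ y := by
  rw [saddlePhi₃_def, saddlePhi₂_def, Finset.mul_sum]
  refine Finset.sum_le_sum fun p hp => ?_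
  have hp2 := two_le_of_mem_primesLE hp
  have hp0 : (0 : ℝ) < p := by linarith
  have hpy : (p : ℝ) ≤ y := by exact_mod_cast (Nat.mem_primesLE.1 hp).1
  have hlog0 : 0 ≤ Real.log p := Real.log_nonneg (by linarith)
  have hlogy : Real.log p ≤ Real.log y := Real.log_le_log hp0 hpy
  set P : ℝ := (p : ℝ) ^ σ with hP
  have hP32 : 3 / 2 ≤ P := three_halves_le_rpow hp hσ
  have hP1 : 0 < P - 1 := by linarith
  -- `(P+1)/(P-1)³ ≤ 5/(P-1)²`
  have hkey : P * (P + 1) / (P - 1) ^ 3 ≤ 5 * (P / (P - 1) ^ 2) := by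
    rw [div_le_iff₀ (by positivity)]
    have : 5 * (P / (P - 1) ^ 2) * (P - 1) ^ 3 = 5 * P * (P - 1) := by field_simp
    rw [this]
    nlinarith
  calc Real.log p ^ 3 * (P * (P + 1) / (P - 1) ^ 3) ≤ Real.log p ^ 3 * (5 * (P / (P - 1) ^ 2)) :=
        mul_le_mul_of_nonneg_left hkey (by positivity)
    _ = Real.log p * (5 * (Real.log p ^ 2 * (P / (P - 1) ^ 2))) := by ring
    _ ≤ Real.log y * (5 * (Real.log p ^ 2 * (P / (P - 1) ^ 2))) :=
        mul_le_mul_of_nonneg_right hlogy (by positivity)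
    _ = 5 * Real.log y * (Real.log p ^ 2 * (P / (P - 1) ^ 2)) := by ring

/-- **`φ₄(σ, y) ≤ 37 log² y · φ₂(σ, y)`** for `σ ≥ 3/5` (termwise `(p^{2σ} + 4p^σ + 1)/(p^σ - 1)² ≤ 37`
as `p^σ ≥ 3/2`). [cite: HildebrandTenenbaum1986, Lemma 4 (3.8), proof] -/
theorem saddlePhi₄_le_mul_saddlePhi₂ (hσ : 3 / 5 ≤ σ) (y : ℕ) :
    saddlePhi₄ σ y ≤ 37 * Real.log y ^ 2 * saddlePhi₂ σ y := by
  rw [saddlePhi₄_def, saddlePhi₂_def, Finset.mul_sum]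
  refine Finset.sum_le_sum fun p hp => ?_
  have hp2 := two_le_of_mem_primesLE hp
  have hp0 : (0 : ℝ) < p := by linarith
  have hpy : (p : ℝ) ≤ y := by exact_mod_cast (Nat.mem_primesLE.1 hp).1
  have hlog0 : 0 ≤ Real.log p := Real.log_nonneg (by linarith)
  have hlogy : Real.log p ≤ Real.log y := Real.log_le_log hp0 hpy
  set P : ℝ := (p : ℝ) ^ σ with hP
  have hP32 : 3 / 2 ≤ P := three_halves_le_rpow hp hσ
  have hP1 : 0 < P - 1 := by linarith
  have hkey : P * (P ^ 2 + 4 * P + 1) / (P - 1) ^ 4 ≤ 37 * (P / (P - 1) ^ 2) := by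
    rw [div_le_iff₀ (by positivity)]
    have : 37 * (P / (P - 1) ^ 2) * (P - 1) ^ 4 = 37 * P * (P - 1) ^ 2 := by field_simp
    rw [this]
    -- `P² + 4P + 1 ≤ 37 (P-1)²` for `P ≥ 3/2`
    nlinarith
  have hlog2 : Real.log p ^ 2 ≤ Real.log y ^ 2 := pow_le_pow_left₀ hlog0 hlogy 2
  calc Real.log p ^ 4 * (P * (P ^ 2 + 4 * P + 1) / (P - 1) ^ 4)
      ≤ Real.log p ^ 4 * (37 * (P / (P - 1) ^ 2)) := mul_le_mul_of_nonneg_left hkey (by positivity)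
    _ = Real.log p ^ 2 * (37 * (Real.log p ^ 2 * (P / (P - 1) ^ 2))) := by ring
    _ ≤ Real.log y ^ 2 * (37 * (Real.log p ^ 2 * (P / (P - 1) ^ 2))) :=
        mul_le_mul_of_nonneg_right hlog2 (by positivity)
    _ = 37 * Real.log y ^ 2 * (Real.log p ^ 2 * (P / (P - 1) ^ 2)) := by ring

/-! ### Uniform upper bounds at the saddle point -/

/-- Regime `σ log y ≤ 1`, termwise for a prime `p ≤ y`: `p^σ ≤ 3` and `p^σ - 1 ≥ σ log p > 0`.
[folklore] -/
theorem rpow_le_three_of_mul_log_le_one (hp : p ∈ Nat.primesLE y) (hσ : 0 < σ)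
    (hσy : σ * Real.log y ≤ 1) : (p : ℝ) ^ σ ≤ 3 := by
  obtain ⟨hpy, hpp⟩ := Nat.mem_primesLE.1 hp
  have hp2 : (2 : ℝ) ≤ p := by exact_mod_cast hpp.two_le
  have hp0 : (0 : ℝ) < p := by linarith
  have hlogpy : Real.log p ≤ Real.log y := Real.log_le_log hp0 (by exact_mod_cast hpy)
  have hlog0 : 0 ≤ Real.log p := Real.log_nonneg (by linarith)
  rw [Real.rpow_def_of_pos hp0]
  have ht : Real.log p * σ ≤ 1 := by nlinarith
  calc Real.exp (Real.log p * σ) ≤ Real.exp 1 := Real.exp_le_exp.2 ht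
    _ ≤ 3 := by have := Real.exp_one_lt_d9; linarith

/-- In the range `x ≥ y` (`y` beyond a threshold): if some prime `q ≤ y` has `q^{α(x,y)} < 5/4` then
`log x ≥ √y/4` (`α < 1/2`, so `log x = -φ₁(α, y) ≥ -φ₁(1/2, y) ≥ y^{-1/2}(θ(y) - θ(√y)) ≥ √y/4`).
[folklore] -/
theorem exists_sqrt_div_four_le_log :
    ∃ y₀ : ℕ, 2 ≤ y₀ ∧ ∀ (x : ℝ) (y : ℕ), y₀ ≤ y → (y : ℝ) ≤ x →
      (∃ q ∈ Nat.primesLE y, (q : ℝ) ^ saddlePoint x y < 5 / 4) → Real.sqrt y / 4 ≤ Real.log x := by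
  obtain ⟨t₁, ht₁2, hθ⟩ := exists_theta_sub_theta_sqrt_ge
  refine ⟨⌈t₁⌉₊, ?_, fun x y hy hyx ⟨q, hq, hqα⟩ => ?_⟩
  · have : (2 : ℝ) ≤ ⌈t₁⌉₊ := le_trans ht₁2 (Nat.le_ceil t₁)
    exact_mod_cast this
  have hyt : t₁ ≤ y := le_trans (Nat.le_ceil t₁) (by exact_mod_cast hy)
  have hy2r : (2 : ℝ) ≤ y := by linarith
  have hy2 : 2 ≤ y := by exact_mod_cast hy2r
  have hy0 : (0 : ℝ) < y := by linarith
  have hx1 : 1 < x := by linarith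
  set α : ℝ := saddlePoint x y with hα
  have hα0 : 0 < α := saddlePoint_pos hx1 hy2
  -- `α < 1/2`
  have hαhalf : α < 1 / 2 := by
    have hq2 : (2 : ℝ) ≤ q := by exact_mod_cast (Nat.prime_of_mem_primesLE hq).two_le
    have h2α : (2 : ℝ) ^ α < 5 / 4 := lt_of_le_of_lt (Real.rpow_le_rpow (by norm_num) hq2 hα0.le) hqα
    have h3 : α * Real.log 2 < Real.log (5 / 4) := by
      have := Real.log_lt_log (Real.rpow_pos_of_pos two_pos α) h2α
      rwa [Real.log_rpow two_pos] at this
    have h4 : Real.log (5 / 4 : ℝ) ≤ 1 / 4 := by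
      have := Real.log_le_sub_one_of_pos (by norm_num : (0 : ℝ) < 5 / 4); linarith
    have hl2 := Real.log_two_gt_d9
    nlinarith
  have h1 : saddleSum (1 / 2) y ≤ saddleSum α y :=
    saddleSum_antitoneOn hα0 (by norm_num : (0 : ℝ) < 1 / 2) hαhalf.le
  rw [saddleSum_saddlePoint hx1 hy2] at h1
  have h2 := sum_primesLE_log_mul_rpow_le_saddleSum (by norm_num : (0 : ℝ) < 1 / 2) y
  have hsy : Real.sqrt y ≤ y := Real.sqrt_le_iff.mpr ⟨hy0.le, by nlinarith⟩
  have hsum' := theta_sub_theta_eq_sum_filter (A := Real.sqrt y) (B := (y : ℝ)) (Real.sqrt_nonneg _) hsy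
  rw [Nat.floor_natCast] at hsum'
  have hθy := hθ y hyt
  have hs0 : 0 < Real.sqrt y := Real.sqrt_pos.2 hy0
  have h3 : (Real.sqrt y)⁻¹ * (θ y - θ (Real.sqrt y)) ≤
      ∑ p ∈ Nat.primesLE y, Real.log p * (p : ℝ) ^ (-(1 / 2 : ℝ)) := by
    rw [hsum', Finset.mul_sum]
    calc ∑ p ∈ (Nat.primesLE y).filter (fun p : ℕ => Real.sqrt y < (p : ℝ)), (Real.sqrt y)⁻¹ * Real.log p
        ≤ ∑ p ∈ (Nat.primesLE y).filter (fun p : ℕ => Real.sqrt y < (p : ℝ)),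
          Real.log p * (p : ℝ) ^ (-(1 / 2 : ℝ)) := by
          refine Finset.sum_le_sum fun p hp => ?_
          rw [Finset.mem_filter, Nat.mem_primesLE] at hp
          obtain ⟨⟨hpy, hpp⟩, -⟩ := hp
          have hp2 : (2 : ℝ) ≤ p := by exact_mod_cast hpp.two_le
          have hp0 : (0 : ℝ) < p := by linarith
          have hlogp : 0 ≤ Real.log p := Real.log_nonneg (by linarith)
          have hpow : (Real.sqrt y)⁻¹ ≤ (p : ℝ) ^ (-(1 / 2 : ℝ)) := by
            rw [Real.sqrt_eq_rpow, ← Real.rpow_neg hy0.le]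
            exact Real.rpow_le_rpow_of_nonpos hp0 (by exact_mod_cast hpy) (by norm_num)
          calc (Real.sqrt y)⁻¹ * Real.log p = Real.log p * (Real.sqrt y)⁻¹ := mul_comm _ _
            _ ≤ Real.log p * (p : ℝ) ^ (-(1 / 2 : ℝ)) := mul_le_mul_of_nonneg_left hpow hlogp
      _ ≤ ∑ p ∈ Nat.primesLE y, Real.log p * (p : ℝ) ^ (-(1 / 2 : ℝ)) := by
          refine Finset.sum_le_sum_of_subset_of_nonneg (Finset.filter_subset _ _) fun p hp _ => ?_
          have hp2 : (2 : ℝ) ≤ p := by exact_mod_cast (Nat.prime_of_mem_primesLE hp).two_le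
          have : 0 ≤ (p : ℝ) ^ (-(1 / 2 : ℝ)) := Real.rpow_nonneg (by linarith) _
          have : 0 ≤ Real.log p := Real.log_nonneg (by linarith)
          positivity
  have h4 : Real.sqrt y / 4 ≤ (Real.sqrt y)⁻¹ * (θ y - θ (Real.sqrt y)) := by
    rw [inv_mul_eq_div, le_div_iff₀ hs0]
    calc Real.sqrt y / 4 * Real.sqrt y = y / 4 := by
          rw [div_mul_eq_mul_div, Real.mul_self_sqrt hy0.le]
      _ ≤ θ y - θ (Real.sqrt y) := hθy
  linarith

/-- In the range `x ≥ y` (`y` beyond a threshold), with `α = α(x, y) > 1/log y`: the primes `p ≤ y`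
with `p^α < 5/4` are at most `y^{1/4} + 1` in number (they lie below `(5/4)^{1/α} ≤ (5/4)^{log y}
≤ y^{1/4}`). [folklore] -/
theorem card_filter_rpow_lt_le {x : ℝ} (hy : 2 ≤ y) (hα : 1 / Real.log y < saddlePoint x y) :
    ((#((Nat.primesLE y).filter (fun p : ℕ => ¬ ((5 : ℝ) / 4 ≤ (p : ℝ) ^ saddlePoint x y))) : ℝ) ≤
      (y : ℝ) ^ (1 / 4 : ℝ) + 1) := by
  have hy1 : (1 : ℝ) < y := by exact_mod_cast lt_of_lt_of_le one_lt_two hy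
  have hy0 : (0 : ℝ) < y := by linarith
  have hℓ : 0 < Real.log y := Real.log_pos hy1
  set α : ℝ := saddlePoint x y with hαdef
  have hα0 : 0 < α := lt_trans (by positivity) hα
  have h1α : 1 / α ≤ Real.log y := by
    rw [div_le_iff₀ hα0]
    have := (div_lt_iff₀ hℓ).1 hα
    linarith
  set B := (Nat.primesLE y).filter (fun p : ℕ => ¬ ((5 : ℝ) / 4 ≤ (p : ℝ) ^ α)) with hBdef
  set N : ℝ := (5 / 4 : ℝ) ^ (1 / α) with hN
  have hN0 : 0 ≤ N := Real.rpow_nonneg (by norm_num) _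
  have hBsub : B ⊆ Finset.range (⌊N⌋₊ + 1) := by
    intro p hp
    rw [hBdef, Finset.mem_filter, not_le] at hp
    obtain ⟨-, hpσ⟩ := hp
    have hp0 : (0 : ℝ) ≤ p := Nat.cast_nonneg p
    rw [Finset.mem_range, Nat.lt_add_one_iff, Nat.le_floor_iff hN0]
    by_contra hcon
    push Not at hcon
    have : N ^ α ≤ (p : ℝ) ^ α := Real.rpow_le_rpow hN0 hcon.le hα0.le
    rw [hN, ← Real.rpow_mul (by norm_num), one_div_mul_cancel hα0.ne', Real.rpow_one] at this
    linarith
  have h1 : #B ≤ ⌊N⌋₊ + 1 := le_trans (Finset.card_le_card hBsub) (by simp)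
  have h2 : (#B : ℝ) ≤ N + 1 := by
    calc (#B : ℝ) ≤ ((⌊N⌋₊ + 1 : ℕ) : ℝ) := by exact_mod_cast h1
      _ = ⌊N⌋₊ + 1 := by push_cast; ring
      _ ≤ N + 1 := by linarith [Nat.floor_le hN0]
  have h3 : N ≤ (y : ℝ) ^ (1 / 4 : ℝ) := by
    calc N ≤ (5 / 4 : ℝ) ^ Real.log y := Real.rpow_le_rpow_of_exponent_le (by norm_num) h1α
      _ = Real.exp (Real.log (5 / 4) * Real.log y) := by rw [Real.rpow_def_of_pos (by norm_num)]
      _ ≤ Real.exp (Real.log y * (1 / 4)) := by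
          rw [Real.exp_le_exp]
          have h4 : Real.log (5 / 4 : ℝ) ≤ 1 / 4 := by
            have := Real.log_le_sub_one_of_pos (by norm_num : (0 : ℝ) < 5 / 4); linarith
          nlinarith
      _ = (y : ℝ) ^ (1 / 4 : ℝ) := by rw [Real.rpow_def_of_pos hy0]
  linarith

/-- **`-φ₃(α(x, y), y) ≪ log x log² y + (log x)³ log² y/y²` uniformly for `x ≥ y ≥ y₀`** — the upper
half of Hildebrand–Tenenbaum's `|φ₃(α, y)| ≍ (u log y)³/ū²` [Lemma 4 (3.8), `k = 3`] over the whole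
range. [cite: HildebrandTenenbaum1986, Lemma 4 (3.8)] -/
theorem exists_saddlePhi₃_saddlePoint_le_uniform :
    ∃ C : ℝ, ∃ y₀ : ℕ, 0 < C ∧ 2 ≤ y₀ ∧ ∀ (x : ℝ) (y : ℕ), y₀ ≤ y → (y : ℝ) ≤ x →
      saddlePhi₃ (saddlePoint x y) y ≤
        C * (Real.log x * Real.log y ^ 2 + Real.log x ^ 3 * Real.log y ^ 2 / y ^ 2) := by
  obtain ⟨y₁, hy₁2, hπ⟩ := exists_card_primesLE_ge
  obtain ⟨y₂, hy₂2, hsqrt⟩ := exists_sqrt_div_four_le_log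
  obtain ⟨Y, hY1, hY⟩ := exists_log_le_mul_rpow (κ := 1 / 24) (ε := 1 / 4) (by norm_num) (by norm_num)
  refine ⟨5184, max (max y₁ y₂) (max ⌈Y⌉₊ 3), by norm_num, le_trans hy₁2 ((le_max_left _ _).trans (le_max_left _ _)),
    fun x y hy hyx => ?_⟩
  have hy₁ : y₁ ≤ y := le_trans ((le_max_left _ _).trans (le_max_left _ _)) hy
  have hy₂ : y₂ ≤ y := le_trans ((le_max_right _ _).trans (le_max_left _ _)) hy
  have hyY : Y ≤ y := le_trans (Nat.le_ceil Y)
    (by exact_mod_cast le_trans ((le_max_left _ _).trans (le_max_right _ _)) hy)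
  have hy3 : 3 ≤ y := le_trans ((le_max_right _ _).trans (le_max_right _ _)) hy
  have hy2 : 2 ≤ y := le_trans (by norm_num) hy3
  have hy1 : (1 : ℝ) < y := by exact_mod_cast lt_of_lt_of_le (by norm_num) hy3
  have hy0 : (0 : ℝ) < y := by linarith
  have hx1 : 1 < x := by linarith
  have hℓ : 0 < Real.log y := Real.log_pos hy1
  have hL : 0 < Real.log x := Real.log_pos hx1
  set ℓ : ℝ := Real.log y with hℓdef
  set L : ℝ := Real.log x with hLdef
  set α : ℝ := saddlePoint x y with hα
  have hα0 : 0 < α := saddlePoint_pos hx1 hy2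
  have hsum : saddleSum α y = L := saddleSum_saddlePoint hx1 hy2
  have hA0 : 0 ≤ L * ℓ ^ 2 := by positivity
  have hB0 : 0 ≤ L ^ 3 * ℓ ^ 2 / y ^ 2 := by positivity
  by_cases hA : α * ℓ ≤ 1
  · -- regime `α log y ≤ 1`: termwise `≤ 12/α³`, so `-φ₃ ≤ 12 π(y)/α³ ≤ 324 L³/π(y)² ≤ 5184 L³ ℓ²/y²`
    have h2 := card_div_le_saddleSum hα0 hA
    rw [hsum] at h2
    have h3 := hπ y hy₁
    set P : ℝ := (#(Nat.primesLE y) : ℝ) with hP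
    have hP0 : 0 < P := lt_of_lt_of_le (by positivity) h3
    have h4 : 1 / α ≤ 3 * L / P := by
      rw [div_le_div_iff₀ hα0 hP0]
      rw [div_le_iff₀ (by positivity)] at h2
      linarith
    have hterm : ∀ p ∈ Nat.primesLE y,
        Real.log p ^ 3 * ((p : ℝ) ^ α * ((p : ℝ) ^ α + 1) / ((p : ℝ) ^ α - 1) ^ 3) ≤ 12 * (1 / α) ^ 3 := by
      intro p hp
      obtain ⟨h1, -⟩ := rpow_sub_one_bounds hp hα0 hA
      have hp2 := two_le_of_mem_primesLE hp
      have hlogp : 0 < Real.log p := Real.log_pos (by linarith)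
      have hQ3 := rpow_le_three_of_mul_log_le_one hp hα0 hA
      set Q : ℝ := (p : ℝ) ^ α with hQ
      have hD : 0 < Q - 1 := lt_of_lt_of_le (mul_pos hα0 hlogp) h1
      have hQ0 : 0 < Q := by linarith
      calc Real.log p ^ 3 * (Q * (Q + 1) / (Q - 1) ^ 3) ≤ Real.log p ^ 3 * (12 / (α * Real.log p) ^ 3) := by
            apply mul_le_mul_of_nonneg_left _ (by positivity)
            calc Q * (Q + 1) / (Q - 1) ^ 3 ≤ 12 / (Q - 1) ^ 3 := by
                  apply div_le_div_of_nonneg_right _ (by positivity); nlinarith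
              _ ≤ 12 / (α * Real.log p) ^ 3 := by
                  apply div_le_div_of_nonneg_left (by norm_num) (by positivity)
                  exact pow_le_pow_left₀ (by positivity) h1 3
        _ = 12 * (1 / α) ^ 3 := by field_simp
    calc saddlePhi₃ α y ≤ ∑ p ∈ Nat.primesLE y, 12 * (1 / α) ^ 3 := Finset.sum_le_sum hterm
      _ = P * (12 * (1 / α) ^ 3) := by rw [Finset.sum_const, nsmul_eq_mul, hP]
      _ ≤ P * (12 * (3 * L / P) ^ 3) := by gcongr
      _ = 324 * L ^ 3 / P ^ 2 := by field_simp; ring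
      _ ≤ 324 * L ^ 3 / (y / (4 * ℓ)) ^ 2 := by
          apply div_le_div_of_nonneg_left (by positivity) (by positivity)
          exact pow_le_pow_left₀ (by positivity) h3 2
      _ = 5184 * (L ^ 3 * ℓ ^ 2 / y ^ 2) := by field_simp; ring
      _ ≤ 5184 * (L * ℓ ^ 2 + L ^ 3 * ℓ ^ 2 / y ^ 2) := by nlinarith
  · -- regime `α log y > 1`
    push Not at hA
    have hαℓ : 1 / Real.log y < α := by rw [div_lt_iff₀ hℓ]; linarith
    have h1α : 1 / α ≤ ℓ := by rw [div_le_iff₀ hα0]; linarith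
    rw [saddlePhi₃_def, ← Finset.sum_filter_add_sum_filter_not (Nat.primesLE y)
      (fun p : ℕ => (5 : ℝ) / 4 ≤ (p : ℝ) ^ α)]
    -- primes with `p^α ≥ 5/4`: termwise `≤ 225 ℓ² log p · p^{-α}`, total `≤ 225 ℓ² L`
    have hG : ∑ p ∈ (Nat.primesLE y).filter (fun p : ℕ => (5 : ℝ) / 4 ≤ (p : ℝ) ^ α),
        Real.log p ^ 3 * ((p : ℝ) ^ α * ((p : ℝ) ^ α + 1) / ((p : ℝ) ^ α - 1) ^ 3) ≤ 225 * (L * ℓ ^ 2) := by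
      have hT := sum_primesLE_log_mul_rpow_le_saddleSum hα0 y
      rw [hsum] at hT
      calc ∑ p ∈ (Nat.primesLE y).filter (fun p : ℕ => (5 : ℝ) / 4 ≤ (p : ℝ) ^ α),
            Real.log p ^ 3 * ((p : ℝ) ^ α * ((p : ℝ) ^ α + 1) / ((p : ℝ) ^ α - 1) ^ 3)
          ≤ ∑ p ∈ (Nat.primesLE y).filter (fun p : ℕ => (5 : ℝ) / 4 ≤ (p : ℝ) ^ α),
            225 * ℓ ^ 2 * (Real.log p * (p : ℝ) ^ (-α)) := by
            refine Finset.sum_le_sum fun p hp => ?_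
            rw [Finset.mem_filter] at hp
            obtain ⟨hp, hP⟩ := hp
            obtain ⟨hpy, hpp⟩ := Nat.mem_primesLE.1 hp
            have hp2 : (2 : ℝ) ≤ p := by exact_mod_cast hpp.two_le
            have hp0 : (0 : ℝ) < p := by linarith
            have hlogp : 0 ≤ Real.log p := Real.log_nonneg (by linarith)
            have hlogpy : Real.log p ≤ ℓ := Real.log_le_log hp0 (by exact_mod_cast hpy)
            set Q : ℝ := (p : ℝ) ^ α with hQdef
            have hQ0 : 0 < Q := Real.rpow_pos_of_pos hp0 α
            have hD : Q / 5 ≤ Q - 1 := by linarith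
            have hD0 : 0 < Q - 1 := by linarith
            have hkey : Q * (Q + 1) / (Q - 1) ^ 3 ≤ 225 * Q⁻¹ := by
              -- `(Q+1) ≤ 9 (Q - 1)` and `(Q-1)² ≥ Q²/25`
              rw [div_le_iff₀ (by positivity)]
              have h9 : Q + 1 ≤ 9 * (Q - 1) := by linarith
              calc Q * (Q + 1) ≤ Q * (9 * (Q - 1)) := mul_le_mul_of_nonneg_left h9 hQ0.le
                _ = 225 * Q⁻¹ * ((Q / 5) ^ 2 * (Q - 1)) := by field_simp; ring
                _ ≤ 225 * Q⁻¹ * ((Q - 1) ^ 2 * (Q - 1)) := by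
                    apply mul_le_mul_of_nonneg_left _ (by positivity)
                    exact mul_le_mul_of_nonneg_right (pow_le_pow_left₀ (by positivity) hD 2) hD0.le
                _ = 225 * Q⁻¹ * (Q - 1) ^ 3 := by ring
            rw [Real.rpow_neg hp0.le, ← hQdef]
            have hlog2 : Real.log p ^ 2 ≤ ℓ ^ 2 := pow_le_pow_left₀ hlogp hlogpy 2
            calc Real.log p ^ 3 * (Q * (Q + 1) / (Q - 1) ^ 3) ≤ Real.log p ^ 3 * (225 * Q⁻¹) :=
                  mul_le_mul_of_nonneg_left hkey (by positivity)
              _ = Real.log p ^ 2 * (225 * (Real.log p * Q⁻¹)) := by ring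
              _ ≤ ℓ ^ 2 * (225 * (Real.log p * Q⁻¹)) := mul_le_mul_of_nonneg_right hlog2 (by positivity)
              _ = 225 * ℓ ^ 2 * (Real.log p * Q⁻¹) := by ring
        _ ≤ ∑ p ∈ Nat.primesLE y, 225 * ℓ ^ 2 * (Real.log p * (p : ℝ) ^ (-α)) := by
            refine Finset.sum_le_sum_of_subset_of_nonneg (Finset.filter_subset _ _) fun p hp _ => ?_
            have hp2 : (2 : ℝ) ≤ p := by exact_mod_cast (Nat.prime_of_mem_primesLE hp).two_le
            have : 0 ≤ (p : ℝ) ^ (-α) := Real.rpow_nonneg (by linarith) _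
            have : 0 ≤ Real.log p := Real.log_nonneg (by linarith)
            positivity
        _ = 225 * ℓ ^ 2 * ∑ p ∈ Nat.primesLE y, Real.log p * (p : ℝ) ^ (-α) := by rw [Finset.mul_sum]
        _ ≤ 225 * ℓ ^ 2 * L := mul_le_mul_of_nonneg_left hT (by positivity)
        _ = 225 * (L * ℓ ^ 2) := by ring
    -- primes with `p^α < 5/4`: termwise `≤ 3 ℓ³`, at most `y^{1/4} + 1` of them, total `≤ L ℓ²`
    have hB : ∑ p ∈ (Nat.primesLE y).filter (fun p : ℕ => ¬ ((5 : ℝ) / 4 ≤ (p : ℝ) ^ α)),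
        Real.log p ^ 3 * ((p : ℝ) ^ α * ((p : ℝ) ^ α + 1) / ((p : ℝ) ^ α - 1) ^ 3) ≤ L * ℓ ^ 2 := by
      set B := (Nat.primesLE y).filter (fun p : ℕ => ¬ ((5 : ℝ) / 4 ≤ (p : ℝ) ^ α)) with hBdef
      rcases B.eq_empty_or_nonempty with hBe | ⟨q, hq⟩
      · rw [hBe, Finset.sum_empty]; exact hA0
      have hq' : ∃ q ∈ Nat.primesLE y, (q : ℝ) ^ saddlePoint x y < 5 / 4 := by
        rw [hBdef, Finset.mem_filter, not_le] at hq
        exact ⟨q, hq.1, hq.2⟩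
      have hLsqrt : Real.sqrt y / 4 ≤ L := hsqrt x y hy₂ hyx hq'
      have hterm : ∀ p ∈ B, Real.log p ^ 3 * ((p : ℝ) ^ α * ((p : ℝ) ^ α + 1) / ((p : ℝ) ^ α - 1) ^ 3) ≤
          3 * ℓ ^ 3 := by
        intro p hp
        rw [hBdef, Finset.mem_filter, not_le] at hp
        obtain ⟨hp, hpα⟩ := hp
        have hp2 : (2 : ℝ) ≤ p := by exact_mod_cast (Nat.prime_of_mem_primesLE hp).two_le
        have hp0 : (0 : ℝ) < p := by linarith
        have hlogp : 0 < Real.log p := Real.log_pos (by linarith)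
        set Q : ℝ := (p : ℝ) ^ α with hQdef
        have hD : α * Real.log p ≤ Q - 1 := by
          rw [hQdef, Real.rpow_def_of_pos hp0]
          have := Real.add_one_le_exp (Real.log p * α)
          nlinarith
        have hD0 : 0 < Q - 1 := lt_of_lt_of_le (mul_pos hα0 hlogp) hD
        have hQ0 : 0 < Q := by linarith
        calc Real.log p ^ 3 * (Q * (Q + 1) / (Q - 1) ^ 3) ≤ Real.log p ^ 3 * (3 / (α * Real.log p) ^ 3) := by
              apply mul_le_mul_of_nonneg_left _ (by positivity)
              calc Q * (Q + 1) / (Q - 1) ^ 3 ≤ 3 / (Q - 1) ^ 3 := by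
                    apply div_le_div_of_nonneg_right _ (by positivity); nlinarith
                _ ≤ 3 / (α * Real.log p) ^ 3 := by
                    apply div_le_div_of_nonneg_left (by norm_num) (by positivity)
                    exact pow_le_pow_left₀ (by positivity) hD 3
          _ = 3 * (1 / α) ^ 3 := by field_simp
          _ ≤ 3 * ℓ ^ 3 := by gcongr
      have hcard := card_filter_rpow_lt_le (x := x) hy2 hαℓ
      rw [← hα, ← hBdef] at hcard
      have hy14 : 1 ≤ (y : ℝ) ^ (1 / 4 : ℝ) := Real.one_le_rpow hy1.le (by norm_num)
      have hlogy_le : ℓ ≤ 1 / 24 * (y : ℝ) ^ (1 / 4 : ℝ) := hY y hyY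
      have hsq : (y : ℝ) ^ (1 / 4 : ℝ) * (y : ℝ) ^ (1 / 4 : ℝ) = Real.sqrt y := by
        rw [← Real.rpow_add hy0, Real.sqrt_eq_rpow]; norm_num
      calc ∑ p ∈ B, Real.log p ^ 3 * ((p : ℝ) ^ α * ((p : ℝ) ^ α + 1) / ((p : ℝ) ^ α - 1) ^ 3)
          ≤ ∑ p ∈ B, 3 * ℓ ^ 3 := Finset.sum_le_sum hterm
        _ = #B * (3 * ℓ ^ 3) := by rw [Finset.sum_const, nsmul_eq_mul]
        _ ≤ ((y : ℝ) ^ (1 / 4 : ℝ) + 1) * (3 * ℓ ^ 3) := mul_le_mul_of_nonneg_right hcard (by positivity)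
        _ ≤ (2 * (y : ℝ) ^ (1 / 4 : ℝ)) * (3 * ℓ ^ 3) := by gcongr; linarith
        _ = 6 * ((y : ℝ) ^ (1 / 4 : ℝ) * ℓ) * ℓ ^ 2 := by ring
        _ ≤ 6 * ((y : ℝ) ^ (1 / 4 : ℝ) * (1 / 24 * (y : ℝ) ^ (1 / 4 : ℝ))) * ℓ ^ 2 := by gcongr
        _ = Real.sqrt y / 4 * ℓ ^ 2 := by rw [← hsq]; ring
        _ ≤ L * ℓ ^ 2 := mul_le_mul_of_nonneg_right hLsqrt (by positivity)
    calc _ ≤ 225 * (L * ℓ ^ 2) + L * ℓ ^ 2 := add_le_add hG hB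
      _ ≤ 5184 * (L * ℓ ^ 2 + L ^ 3 * ℓ ^ 2 / y ^ 2) := by nlinarith

/-- **`φ₄(α(x, y), y) ≪ log x log³ y + (log x)⁴ log³ y/y³` uniformly for `x ≥ y ≥ y₀`** — the upper
half of Hildebrand–Tenenbaum's `φ₄(α, y) ≍ (u log y)⁴/ū³` [Lemma 4 (3.8), `k = 4`] over the whole range.
[cite: HildebrandTenenbaum1986, Lemma 4 (3.8)] -/
theorem exists_saddlePhi₄_saddlePoint_le_uniform :
    ∃ C : ℝ, ∃ y₀ : ℕ, 0 < C ∧ 2 ≤ y₀ ∧ ∀ (x : ℝ) (y : ℕ), y₀ ≤ y → (y : ℝ) ≤ x →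
      saddlePhi₄ (saddlePoint x y) y ≤
        C * (Real.log x * Real.log y ^ 3 + Real.log x ^ 4 * Real.log y ^ 3 / y ^ 3) := by
  obtain ⟨y₁, hy₁2, hπ⟩ := exists_card_primesLE_ge
  obtain ⟨y₂, hy₂2, hsqrt⟩ := exists_sqrt_div_four_le_log
  obtain ⟨Y, hY1, hY⟩ := exists_log_le_mul_rpow (κ := 1 / 80) (ε := 1 / 4) (by norm_num) (by norm_num)
  refine ⟨342144, max (max y₁ y₂) (max ⌈Y⌉₊ 3), by norm_num,
    le_trans hy₁2 ((le_max_left _ _).trans (le_max_left _ _)), fun x y hy hyx => ?_⟩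
  have hy₁ : y₁ ≤ y := le_trans ((le_max_left _ _).trans (le_max_left _ _)) hy
  have hy₂ : y₂ ≤ y := le_trans ((le_max_right _ _).trans (le_max_left _ _)) hy
  have hyY : Y ≤ y := le_trans (Nat.le_ceil Y)
    (by exact_mod_cast le_trans ((le_max_left _ _).trans (le_max_right _ _)) hy)
  have hy3 : 3 ≤ y := le_trans ((le_max_right _ _).trans (le_max_right _ _)) hy
  have hy2 : 2 ≤ y := le_trans (by norm_num) hy3
  have hy1 : (1 : ℝ) < y := by exact_mod_cast lt_of_lt_of_le (by norm_num) hy3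
  have hy0 : (0 : ℝ) < y := by linarith
  have hx1 : 1 < x := by linarith
  have hℓ : 0 < Real.log y := Real.log_pos hy1
  have hL : 0 < Real.log x := Real.log_pos hx1
  set ℓ : ℝ := Real.log y with hℓdef
  set L : ℝ := Real.log x with hLdef
  set α : ℝ := saddlePoint x y with hα
  have hα0 : 0 < α := saddlePoint_pos hx1 hy2
  have hsum : saddleSum α y = L := saddleSum_saddlePoint hx1 hy2
  have hA0 : 0 ≤ L * ℓ ^ 3 := by positivity
  have hB0 : 0 ≤ L ^ 4 * ℓ ^ 3 / y ^ 3 := by positivity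
  by_cases hA : α * ℓ ≤ 1
  · -- regime `α log y ≤ 1`: termwise `≤ 66/α⁴`, so `φ₄ ≤ 66 π(y)/α⁴ ≤ 5346 L⁴/π(y)³ ≤ 342144 L⁴ℓ³/y³`
    have h2 := card_div_le_saddleSum hα0 hA
    rw [hsum] at h2
    have h3 := hπ y hy₁
    set P : ℝ := (#(Nat.primesLE y) : ℝ) with hP
    have hP0 : 0 < P := lt_of_lt_of_le (by positivity) h3
    have h4 : 1 / α ≤ 3 * L / P := by
      rw [div_le_div_iff₀ hα0 hP0]
      rw [div_le_iff₀ (by positivity)] at h2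
      linarith
    have hterm : ∀ p ∈ Nat.primesLE y,
        Real.log p ^ 4 * ((p : ℝ) ^ α * (((p : ℝ) ^ α) ^ 2 + 4 * (p : ℝ) ^ α + 1) / ((p : ℝ) ^ α - 1) ^ 4) ≤
          66 * (1 / α) ^ 4 := by
      intro p hp
      obtain ⟨h1, -⟩ := rpow_sub_one_bounds hp hα0 hA
      have hp2 := two_le_of_mem_primesLE hp
      have hlogp : 0 < Real.log p := Real.log_pos (by linarith)
      have hQ3 := rpow_le_three_of_mul_log_le_one hp hα0 hA
      set Q : ℝ := (p : ℝ) ^ α with hQ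
      have hD : 0 < Q - 1 := lt_of_lt_of_le (mul_pos hα0 hlogp) h1
      have hQ0 : 0 < Q := by linarith
      calc Real.log p ^ 4 * (Q * (Q ^ 2 + 4 * Q + 1) / (Q - 1) ^ 4)
          ≤ Real.log p ^ 4 * (66 / (α * Real.log p) ^ 4) := by
            apply mul_le_mul_of_nonneg_left _ (by positivity)
            calc Q * (Q ^ 2 + 4 * Q + 1) / (Q - 1) ^ 4 ≤ 66 / (Q - 1) ^ 4 := by
                  apply div_le_div_of_nonneg_right _ (by positivity); nlinarith
              _ ≤ 66 / (α * Real.log p) ^ 4 := by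
                  apply div_le_div_of_nonneg_left (by norm_num) (by positivity)
                  exact pow_le_pow_left₀ (by positivity) h1 4
        _ = 66 * (1 / α) ^ 4 := by field_simp
    calc saddlePhi₄ α y ≤ ∑ p ∈ Nat.primesLE y, 66 * (1 / α) ^ 4 := Finset.sum_le_sum hterm
      _ = P * (66 * (1 / α) ^ 4) := by rw [Finset.sum_const, nsmul_eq_mul, hP]
      _ ≤ P * (66 * (3 * L / P) ^ 4) := by gcongr
      _ = 5346 * L ^ 4 / P ^ 3 := by field_simp; ring
      _ ≤ 5346 * L ^ 4 / (y / (4 * ℓ)) ^ 3 := by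
          apply div_le_div_of_nonneg_left (by positivity) (by positivity)
          exact pow_le_pow_left₀ (by positivity) h3 3
      _ = 342144 * (L ^ 4 * ℓ ^ 3 / y ^ 3) := by field_simp; ring
      _ ≤ 342144 * (L * ℓ ^ 3 + L ^ 4 * ℓ ^ 3 / y ^ 3) := by nlinarith
  · -- regime `α log y > 1`
    push Not at hA
    have hαℓ : 1 / Real.log y < α := by rw [div_lt_iff₀ hℓ]; linarith
    have h1α : 1 / α ≤ ℓ := by rw [div_le_iff₀ hα0]; linarith
    rw [saddlePhi₄_def, ← Finset.sum_filter_add_sum_filter_not (Nat.primesLE y)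
      (fun p : ℕ => (5 : ℝ) / 4 ≤ (p : ℝ) ^ α)]
    have hG : ∑ p ∈ (Nat.primesLE y).filter (fun p : ℕ => (5 : ℝ) / 4 ≤ (p : ℝ) ^ α),
        Real.log p ^ 4 * ((p : ℝ) ^ α * (((p : ℝ) ^ α) ^ 2 + 4 * (p : ℝ) ^ α + 1) / ((p : ℝ) ^ α - 1) ^ 4) ≤
          3025 * (L * ℓ ^ 3) := by
      have hT := sum_primesLE_log_mul_rpow_le_saddleSum hα0 y
      rw [hsum] at hT
      calc ∑ p ∈ (Nat.primesLE y).filter (fun p : ℕ => (5 : ℝ) / 4 ≤ (p : ℝ) ^ α),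
            Real.log p ^ 4 * ((p : ℝ) ^ α * (((p : ℝ) ^ α) ^ 2 + 4 * (p : ℝ) ^ α + 1) / ((p : ℝ) ^ α - 1) ^ 4)
          ≤ ∑ p ∈ (Nat.primesLE y).filter (fun p : ℕ => (5 : ℝ) / 4 ≤ (p : ℝ) ^ α),
            3025 * ℓ ^ 3 * (Real.log p * (p : ℝ) ^ (-α)) := by
            refine Finset.sum_le_sum fun p hp => ?_
            rw [Finset.mem_filter] at hp
            obtain ⟨hp, hP⟩ := hp
            obtain ⟨hpy, hpp⟩ := Nat.mem_primesLE.1 hp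
            have hp2 : (2 : ℝ) ≤ p := by exact_mod_cast hpp.two_le
            have hp0 : (0 : ℝ) < p := by linarith
            have hlogp : 0 ≤ Real.log p := Real.log_nonneg (by linarith)
            have hlogpy : Real.log p ≤ ℓ := Real.log_le_log hp0 (by exact_mod_cast hpy)
            set Q : ℝ := (p : ℝ) ^ α with hQdef
            have hQ0 : 0 < Q := Real.rpow_pos_of_pos hp0 α
            have hD : Q / 5 ≤ Q - 1 := by linarith
            have hD0 : 0 < Q - 1 := by linarith
            have hkey : Q * (Q ^ 2 + 4 * Q + 1) / (Q - 1) ^ 4 ≤ 3025 * Q⁻¹ := by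
              -- `Q² + 4Q + 1 ≤ 121 (Q-1)²` and `(Q-1)² ≥ Q²/25`
              rw [div_le_iff₀ (by positivity)]
              have h121 : Q ^ 2 + 4 * Q + 1 ≤ 121 * (Q - 1) ^ 2 := by nlinarith
              calc Q * (Q ^ 2 + 4 * Q + 1) ≤ Q * (121 * (Q - 1) ^ 2) := mul_le_mul_of_nonneg_left h121 hQ0.le
                _ = 3025 * Q⁻¹ * ((Q / 5) ^ 2 * (Q - 1) ^ 2) := by field_simp; ring
                _ ≤ 3025 * Q⁻¹ * ((Q - 1) ^ 2 * (Q - 1) ^ 2) := by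
                    apply mul_le_mul_of_nonneg_left _ (by positivity)
                    exact mul_le_mul_of_nonneg_right (pow_le_pow_left₀ (by positivity) hD 2) (by positivity)
                _ = 3025 * Q⁻¹ * (Q - 1) ^ 4 := by ring
            rw [Real.rpow_neg hp0.le, ← hQdef]
            have hlog3 : Real.log p ^ 3 ≤ ℓ ^ 3 := pow_le_pow_left₀ hlogp hlogpy 3
            calc Real.log p ^ 4 * (Q * (Q ^ 2 + 4 * Q + 1) / (Q - 1) ^ 4) ≤ Real.log p ^ 4 * (3025 * Q⁻¹) :=
                  mul_le_mul_of_nonneg_left hkey (by positivity)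
              _ = Real.log p ^ 3 * (3025 * (Real.log p * Q⁻¹)) := by ring
              _ ≤ ℓ ^ 3 * (3025 * (Real.log p * Q⁻¹)) := mul_le_mul_of_nonneg_right hlog3 (by positivity)
              _ = 3025 * ℓ ^ 3 * (Real.log p * Q⁻¹) := by ring
        _ ≤ ∑ p ∈ Nat.primesLE y, 3025 * ℓ ^ 3 * (Real.log p * (p : ℝ) ^ (-α)) := by
            refine Finset.sum_le_sum_of_subset_of_nonneg (Finset.filter_subset _ _) fun p hp _ => ?_
            have hp2 : (2 : ℝ) ≤ p := by exact_mod_cast (Nat.prime_of_mem_primesLE hp).two_le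
            have : 0 ≤ (p : ℝ) ^ (-α) := Real.rpow_nonneg (by linarith) _
            have : 0 ≤ Real.log p := Real.log_nonneg (by linarith)
            positivity
        _ = 3025 * ℓ ^ 3 * ∑ p ∈ Nat.primesLE y, Real.log p * (p : ℝ) ^ (-α) := by rw [Finset.mul_sum]
        _ ≤ 3025 * ℓ ^ 3 * L := mul_le_mul_of_nonneg_left hT (by positivity)
        _ = 3025 * (L * ℓ ^ 3) := by ring
    have hB : ∑ p ∈ (Nat.primesLE y).filter (fun p : ℕ => ¬ ((5 : ℝ) / 4 ≤ (p : ℝ) ^ α)),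
        Real.log p ^ 4 * ((p : ℝ) ^ α * (((p : ℝ) ^ α) ^ 2 + 4 * (p : ℝ) ^ α + 1) / ((p : ℝ) ^ α - 1) ^ 4) ≤
          L * ℓ ^ 3 := by
      set B := (Nat.primesLE y).filter (fun p : ℕ => ¬ ((5 : ℝ) / 4 ≤ (p : ℝ) ^ α)) with hBdef
      rcases B.eq_empty_or_nonempty with hBe | ⟨q, hq⟩
      · rw [hBe, Finset.sum_empty]; exact hA0
      have hq' : ∃ q ∈ Nat.primesLE y, (q : ℝ) ^ saddlePoint x y < 5 / 4 := by
        rw [hBdef, Finset.mem_filter, not_le] at hq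
        exact ⟨q, hq.1, hq.2⟩
      have hLsqrt : Real.sqrt y / 4 ≤ L := hsqrt x y hy₂ hyx hq'
      have hterm : ∀ p ∈ B, Real.log p ^ 4 *
          ((p : ℝ) ^ α * (((p : ℝ) ^ α) ^ 2 + 4 * (p : ℝ) ^ α + 1) / ((p : ℝ) ^ α - 1) ^ 4) ≤ 10 * ℓ ^ 4 := by
        intro p hp
        rw [hBdef, Finset.mem_filter, not_le] at hp
        obtain ⟨hp, hpα⟩ := hp
        have hp2 : (2 : ℝ) ≤ p := by exact_mod_cast (Nat.prime_of_mem_primesLE hp).two_le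
        have hp0 : (0 : ℝ) < p := by linarith
        have hlogp : 0 < Real.log p := Real.log_pos (by linarith)
        set Q : ℝ := (p : ℝ) ^ α with hQdef
        have hD : α * Real.log p ≤ Q - 1 := by
          rw [hQdef, Real.rpow_def_of_pos hp0]
          have := Real.add_one_le_exp (Real.log p * α)
          nlinarith
        have hD0 : 0 < Q - 1 := lt_of_lt_of_le (mul_pos hα0 hlogp) hD
        have hQ0 : 0 < Q := by linarith
        calc Real.log p ^ 4 * (Q * (Q ^ 2 + 4 * Q + 1) / (Q - 1) ^ 4)
            ≤ Real.log p ^ 4 * (10 / (α * Real.log p) ^ 4) := by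
              apply mul_le_mul_of_nonneg_left _ (by positivity)
              calc Q * (Q ^ 2 + 4 * Q + 1) / (Q - 1) ^ 4 ≤ 10 / (Q - 1) ^ 4 := by
                    apply div_le_div_of_nonneg_right _ (by positivity); nlinarith
                _ ≤ 10 / (α * Real.log p) ^ 4 := by
                    apply div_le_div_of_nonneg_left (by norm_num) (by positivity)
                    exact pow_le_pow_left₀ (by positivity) hD 4
          _ = 10 * (1 / α) ^ 4 := by field_simp
          _ ≤ 10 * ℓ ^ 4 := by gcongr
      have hcard := card_filter_rpow_lt_le (x := x) hy2 hαℓ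
      rw [← hα, ← hBdef] at hcard
      have hy14 : 1 ≤ (y : ℝ) ^ (1 / 4 : ℝ) := Real.one_le_rpow hy1.le (by norm_num)
      have hlogy_le : ℓ ≤ 1 / 80 * (y : ℝ) ^ (1 / 4 : ℝ) := hY y hyY
      have hsq : (y : ℝ) ^ (1 / 4 : ℝ) * (y : ℝ) ^ (1 / 4 : ℝ) = Real.sqrt y := by
        rw [← Real.rpow_add hy0, Real.sqrt_eq_rpow]; norm_num
      calc ∑ p ∈ B, Real.log p ^ 4 *
            ((p : ℝ) ^ α * (((p : ℝ) ^ α) ^ 2 + 4 * (p : ℝ) ^ α + 1) / ((p : ℝ) ^ α - 1) ^ 4)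
          ≤ ∑ p ∈ B, 10 * ℓ ^ 4 := Finset.sum_le_sum hterm
        _ = #B * (10 * ℓ ^ 4) := by rw [Finset.sum_const, nsmul_eq_mul]
        _ ≤ ((y : ℝ) ^ (1 / 4 : ℝ) + 1) * (10 * ℓ ^ 4) := mul_le_mul_of_nonneg_right hcard (by positivity)
        _ ≤ (2 * (y : ℝ) ^ (1 / 4 : ℝ)) * (10 * ℓ ^ 4) := by gcongr; linarith
        _ = 20 * ((y : ℝ) ^ (1 / 4 : ℝ) * ℓ) * ℓ ^ 3 := by ring
        _ ≤ 20 * ((y : ℝ) ^ (1 / 4 : ℝ) * (1 / 80 * (y : ℝ) ^ (1 / 4 : ℝ))) * ℓ ^ 3 := by gcongr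
        _ = Real.sqrt y / 4 * ℓ ^ 3 := by rw [← hsq]; ring
        _ ≤ L * ℓ ^ 3 := mul_le_mul_of_nonneg_right hLsqrt (by positivity)
    calc _ ≤ 3025 * (L * ℓ ^ 3) + L * ℓ ^ 3 := add_le_add hG hB
      _ ≤ 342144 * (L * ℓ ^ 3 + L ^ 4 * ℓ ^ 3 / y ^ 3) := by nlinarith

/-! ### Complex `s`: `φ₃(s, y)`, `φ₄(s, y)`, the derivative chain, modulus and Lipschitz bounds -/

section Complex

open Complex

variable {s : ℂ} {t : ℝ}

/-- `-φ₃(s, y) = Σ_{p ≤ y} log³ p · p^s (p^s + 1)/(p^s - 1)³` at complex `s` (the complex extension of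
`saddlePhi₃`). [cite: HildebrandTenenbaum1986, §2 (definition of φ_k)] -/
def smoothPhi₃ (s : ℂ) (y : ℕ) : ℂ :=
  ∑ p ∈ Nat.primesLE y, (Real.log p : ℂ) ^ 3 * ((p : ℂ) ^ s * ((p : ℂ) ^ s + 1) / ((p : ℂ) ^ s - 1) ^ 3)

/-- `φ₄(s, y) = Σ_{p ≤ y} log⁴ p · p^s (p^{2s} + 4p^s + 1)/(p^s - 1)⁴` at complex `s` (the complex extension
of `saddlePhi₄`). [cite: HildebrandTenenbaum1986, §2 (definition of φ_k)] -/
def smoothPhi₄ (s : ℂ) (y : ℕ) : ℂ :=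
  ∑ p ∈ Nat.primesLE y, (Real.log p : ℂ) ^ 4 *
    ((p : ℂ) ^ s * (((p : ℂ) ^ s) ^ 2 + 4 * (p : ℂ) ^ s + 1) / ((p : ℂ) ^ s - 1) ^ 4)

/-- At a real point, `smoothPhi₃ σ y = saddlePhi₃ σ y`. [folklore] -/
theorem smoothPhi₃_ofReal (σ : ℝ) (y : ℕ) : smoothPhi₃ σ y = (saddlePhi₃ σ y : ℂ) := by
  rw [smoothPhi₃, saddlePhi₃]
  push_cast
  refine Finset.sum_congr rfl fun p _ => ?_
  have hp0 : (0 : ℝ) ≤ p := Nat.cast_nonneg _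
  rw [show (p : ℂ) = ((p : ℝ) : ℂ) by simp, ← Complex.ofReal_cpow hp0 σ]

/-- At a real point, `smoothPhi₄ σ y = saddlePhi₄ σ y`. [folklore] -/
theorem smoothPhi₄_ofReal (σ : ℝ) (y : ℕ) : smoothPhi₄ σ y = (saddlePhi₄ σ y : ℂ) := by
  rw [smoothPhi₄, saddlePhi₄]
  push_cast
  refine Finset.sum_congr rfl fun p _ => ?_
  have hp0 : (0 : ℝ) ≤ p := Nat.cast_nonneg _
  rw [show (p : ℂ) = ((p : ℝ) : ℂ) by simp, ← Complex.ofReal_cpow hp0 σ]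

/-- **`φ₂'(s, y) = φ₃(s, y) = -smoothPhi₃ s y`** (`Re s > 0`).
[cite: HildebrandTenenbaum1986, §2 (definition of φ_k)] -/
theorem hasDerivAt_smoothPhi₂ (hs : 0 < s.re) (y : ℕ) :
    HasDerivAt (fun z : ℂ => smoothPhi₂ z y) (-smoothPhi₃ s y) s := by
  have hterm : ∀ p ∈ Nat.primesLE y,
      HasDerivAt (fun z : ℂ => (Real.log p : ℂ) ^ 2 * ((p : ℂ) ^ z / ((p : ℂ) ^ z - 1) ^ 2))
        (-((Real.log p : ℂ) ^ 3 * ((p : ℂ) ^ s * ((p : ℂ) ^ s + 1) / ((p : ℂ) ^ s - 1) ^ 3))) s := by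
    intro p hp
    have hp2 := (Nat.mem_primesLE.1 hp).2.two_le
    have hp0 : 0 < p := by omega
    have hne := cpow_sub_one_ne_zero hp2 hs
    have hne2 : ((p : ℂ) ^ s - 1) ^ 2 ≠ 0 := pow_ne_zero 2 hne
    have h1 := hasDerivAt_natCast_cpow hp0 s
    have h2 : HasDerivAt (fun z : ℂ => ((p : ℂ) ^ z - 1) ^ 2)
        ((2 : ℕ) * ((p : ℂ) ^ s - 1) ^ (2 - 1) * ((Real.log p : ℂ) * (p : ℂ) ^ s)) s :=
      (h1.sub_const 1).pow 2
    have h3 := (h1.div h2 hne2).const_mul ((Real.log p : ℂ) ^ 2)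
    refine h3.congr_deriv ?_
    field_simp
    push_cast
    ring
  exact (HasDerivAt.fun_sum hterm).congr_deriv (by rw [Finset.sum_neg_distrib, smoothPhi₃])

/-- **`(-φ₃)'(s, y) = -φ₄(s, y)`** (`Re s > 0`). [cite: HildebrandTenenbaum1986, §2 (definition of φ_k)] -/
theorem hasDerivAt_smoothPhi₃ (hs : 0 < s.re) (y : ℕ) :
    HasDerivAt (fun z : ℂ => smoothPhi₃ z y) (-smoothPhi₄ s y) s := by
  have hterm : ∀ p ∈ Nat.primesLE y,
      HasDerivAt (fun z : ℂ => (Real.log p : ℂ) ^ 3 * ((p : ℂ) ^ z * ((p : ℂ) ^ z + 1) / ((p : ℂ) ^ z - 1) ^ 3))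
        (-((Real.log p : ℂ) ^ 4 * ((p : ℂ) ^ s * (((p : ℂ) ^ s) ^ 2 + 4 * (p : ℂ) ^ s + 1) /
          ((p : ℂ) ^ s - 1) ^ 4))) s := by
    intro p hp
    have hp2 := (Nat.mem_primesLE.1 hp).2.two_le
    have hp0 : 0 < p := by omega
    have hne := cpow_sub_one_ne_zero hp2 hs
    have hne3 : ((p : ℂ) ^ s - 1) ^ 3 ≠ 0 := pow_ne_zero 3 hne
    have h1 := hasDerivAt_natCast_cpow hp0 s
    have hnum : HasDerivAt (fun z : ℂ => (p : ℂ) ^ z * ((p : ℂ) ^ z + 1))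
        ((Real.log p : ℂ) * (p : ℂ) ^ s * ((p : ℂ) ^ s + 1) +
          (p : ℂ) ^ s * ((Real.log p : ℂ) * (p : ℂ) ^ s)) s := h1.mul (h1.add_const 1)
    have hden : HasDerivAt (fun z : ℂ => ((p : ℂ) ^ z - 1) ^ 3)
        ((3 : ℕ) * ((p : ℂ) ^ s - 1) ^ (3 - 1) * ((Real.log p : ℂ) * (p : ℂ) ^ s)) s :=
      (h1.sub_const 1).pow 3
    have h3 := (hnum.div hden hne3).const_mul ((Real.log p : ℂ) ^ 3)
    refine h3.congr_deriv ?_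
    field_simp
    push_cast
    ring
  exact (HasDerivAt.fun_sum hterm).congr_deriv (by rw [Finset.sum_neg_distrib, smoothPhi₄])

/-- `‖p^{σ+it}‖ = p^σ`, and `‖p^{σ+it} - 1‖ ≥ p^σ - 1`. [folklore] -/
theorem norm_cpow_line (hp : p ∈ Nat.primesLE y) (σ t : ℝ) :
    ‖(p : ℂ) ^ ((σ : ℂ) + t * I)‖ = (p : ℝ) ^ σ ∧
      (p : ℝ) ^ σ - 1 ≤ ‖(p : ℂ) ^ ((σ : ℂ) + t * I) - 1‖ := by
  have hp0 : 0 < p := (Nat.mem_primesLE.1 hp).2.pos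
  have hp0r : (0 : ℝ) < p := by exact_mod_cast hp0
  have h1 : ‖(p : ℂ) ^ ((σ : ℂ) + t * I)‖ = (p : ℝ) ^ σ := by
    rw [natCast_cpow_add_mul_I hp0 σ t, norm_mul, Complex.norm_exp_ofReal_mul_I, mul_one, Complex.norm_real,
      Real.norm_eq_abs, abs_of_pos (Real.rpow_pos_of_pos hp0r σ)]
  refine ⟨h1, ?_⟩
  have := norm_sub_norm_le ((p : ℂ) ^ ((σ : ℂ) + t * I)) 1
  rwa [h1, norm_one] at this

/-- **`|φ₃(σ + it, y)| ≤ -φ₃(σ, y)`** (`σ > 0`): termwise `|w (w+1)/(w-1)³| ≤ a(a+1)/(a-1)³` for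
`w = p^{σ+it}`, `a = |w| = p^σ > 1`. [cite: HildebrandTenenbaum1986, §4 (proof of Lemma 11)] -/
theorem norm_smoothPhi₃_le (hσ : 0 < σ) (t : ℝ) (y : ℕ) :
    ‖smoothPhi₃ ((σ : ℂ) + t * I) y‖ ≤ saddlePhi₃ σ y := by
  rw [smoothPhi₃, saddlePhi₃]
  refine (norm_sum_le _ _).trans (Finset.sum_le_sum fun p hp => ?_)
  have hp2r : (2 : ℝ) ≤ p := by exact_mod_cast (Nat.mem_primesLE.1 hp).2.two_le
  have hlogp0 : 0 ≤ Real.log p := Real.log_nonneg (by linarith)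
  obtain ⟨hnormw, hw1⟩ := norm_cpow_line hp σ t
  set a : ℝ := (p : ℝ) ^ σ with ha
  have ha1 : 1 < a := Real.one_lt_rpow (by linarith) hσ
  set w : ℂ := (p : ℂ) ^ ((σ : ℂ) + t * I) with hw
  have hw1pos : 0 < ‖w - 1‖ := by linarith
  have hwp1 : ‖w + 1‖ ≤ a + 1 := by
    calc ‖w + 1‖ ≤ ‖w‖ + ‖(1 : ℂ)‖ := norm_add_le _ _
      _ = a + 1 := by rw [hnormw, norm_one]
  rw [norm_mul, norm_pow, Complex.norm_real, Real.norm_eq_abs, abs_of_nonneg hlogp0]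
  refine mul_le_mul_of_nonneg_left ?_ (by positivity)
  rw [norm_div, norm_mul, norm_pow, hnormw]
  calc a * ‖w + 1‖ / ‖w - 1‖ ^ 3 ≤ a * (a + 1) / ‖w - 1‖ ^ 3 := by gcongr
    _ ≤ a * (a + 1) / (a - 1) ^ 3 := by
        apply div_le_div_of_nonneg_left (by positivity) (by positivity)
        exact pow_le_pow_left₀ (by linarith) hw1 3

/-- **`|φ₄(σ + it, y)| ≤ φ₄(σ, y)`** (`σ > 0`): termwise `|w (w²+4w+1)/(w-1)⁴| ≤ a(a²+4a+1)/(a-1)⁴`.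
[cite: HildebrandTenenbaum1986, §4 (proof of Lemma 11)] -/
theorem norm_smoothPhi₄_le (hσ : 0 < σ) (t : ℝ) (y : ℕ) :
    ‖smoothPhi₄ ((σ : ℂ) + t * I) y‖ ≤ saddlePhi₄ σ y := by
  rw [smoothPhi₄, saddlePhi₄]
  refine (norm_sum_le _ _).trans (Finset.sum_le_sum fun p hp => ?_)
  have hp2r : (2 : ℝ) ≤ p := by exact_mod_cast (Nat.mem_primesLE.1 hp).2.two_le
  have hlogp0 : 0 ≤ Real.log p := Real.log_nonneg (by linarith)
  obtain ⟨hnormw, hw1⟩ := norm_cpow_line hp σ t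
  set a : ℝ := (p : ℝ) ^ σ with ha
  have ha1 : 1 < a := Real.one_lt_rpow (by linarith) hσ
  set w : ℂ := (p : ℂ) ^ ((σ : ℂ) + t * I) with hw
  have hw1pos : 0 < ‖w - 1‖ := by linarith
  have hpoly : ‖w ^ 2 + 4 * w + 1‖ ≤ a ^ 2 + 4 * a + 1 := by
    calc ‖w ^ 2 + 4 * w + 1‖ ≤ ‖w ^ 2 + 4 * w‖ + ‖(1 : ℂ)‖ := norm_add_le _ _
      _ ≤ ‖w ^ 2‖ + ‖4 * w‖ + ‖(1 : ℂ)‖ := by gcongr; exact norm_add_le _ _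
      _ = a ^ 2 + 4 * a + 1 := by
          rw [norm_pow, norm_mul, hnormw, norm_one]
          norm_num
  rw [norm_mul, norm_pow, Complex.norm_real, Real.norm_eq_abs, abs_of_nonneg hlogp0]
  refine mul_le_mul_of_nonneg_left ?_ (by positivity)
  rw [norm_div, norm_mul, norm_pow, hnormw]
  calc a * ‖w ^ 2 + 4 * w + 1‖ / ‖w - 1‖ ^ 4 ≤ a * (a ^ 2 + 4 * a + 1) / ‖w - 1‖ ^ 4 := by gcongr
    _ ≤ a * (a ^ 2 + 4 * a + 1) / (a - 1) ^ 4 := by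
        apply div_le_div_of_nonneg_left (by positivity) (by positivity)
        exact pow_le_pow_left₀ (by linarith) hw1 4

/-- The inner affine map `w ↦ σ + iw` has derivative `i`. [folklore] -/
private theorem hasDerivAt_add_mul_I' (σ : ℝ) (z : ℂ) : HasDerivAt (fun w : ℂ => (σ : ℂ) + w * I) I z := by
  simpa using ((hasDerivAt_id z).mul_const I).const_add (σ : ℂ)

/-- **`φ₂` is Lipschitz off the real axis, uniformly in `σ > 0`**:
`‖φ₂(σ + it, y) - φ₂(σ, y)‖ ≤ |t| · (-φ₃(σ, y))` (mean value inequality along `u ↦ σ + iu` with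
`‖φ₃(σ + iu, y)‖ ≤ -φ₃(σ, y)`). [cite: HildebrandTenenbaum1986, §4 (proof of Lemma 11)] -/
theorem norm_smoothPhi₂_sub_le_mul_saddlePhi₃ (hσ : 0 < σ) (t : ℝ) (y : ℕ) :
    ‖smoothPhi₂ ((σ : ℂ) + t * I) y - smoothPhi₂ σ y‖ ≤ |t| * saddlePhi₃ σ y := by
  set F : ℝ → ℂ := fun u => smoothPhi₂ ((σ : ℂ) + u * I) y with hF
  have hre : ∀ u : ℝ, 0 < ((σ : ℂ) + (u : ℂ) * I).re := fun u => by simp [hσ]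
  have hFd : ∀ u : ℝ, HasDerivAt F (-smoothPhi₃ ((σ : ℂ) + u * I) y * I) u := by
    intro u
    have h := HasDerivAt.comp (h₂ := fun z : ℂ => smoothPhi₂ z y) (u : ℂ) (hasDerivAt_smoothPhi₂ (hre u) y)
      (hasDerivAt_add_mul_I' σ u)
    exact h.comp_ofReal
  have hbound : ∀ u ∈ Set.uIcc 0 t, ‖-smoothPhi₃ ((σ : ℂ) + u * I) y * I‖ ≤ saddlePhi₃ σ y := by
    intro u _
    rw [norm_mul, norm_neg, Complex.norm_I, mul_one]
    exact norm_smoothPhi₃_le hσ u y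
  have h := (convex_uIcc (0 : ℝ) t).norm_image_sub_le_of_norm_hasDerivWithin_le
    (fun v _ => (hFd v).hasDerivWithinAt) hbound Set.left_mem_uIcc Set.right_mem_uIcc
  have hF0 : F 0 = smoothPhi₂ σ y := by simp [hF]
  rw [hF0, sub_zero, Real.norm_eq_abs] at h
  calc ‖smoothPhi₂ ((σ : ℂ) + t * I) y - smoothPhi₂ σ y‖ = ‖F t - smoothPhi₂ σ y‖ := rfl
    _ ≤ saddlePhi₃ σ y * |t| := h
    _ = |t| * saddlePhi₃ σ y := mul_comm _ _

/-- **`φ₃` is Lipschitz off the real axis, uniformly in `σ > 0`**: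
`‖φ₃(σ + it, y) - φ₃(σ, y)‖ ≤ |t| · φ₄(σ, y)`. [cite: HildebrandTenenbaum1986, §4 (proof of Lemma 11)] -/
theorem norm_smoothPhi₃_sub_le_mul_saddlePhi₄ (hσ : 0 < σ) (t : ℝ) (y : ℕ) :
    ‖smoothPhi₃ ((σ : ℂ) + t * I) y - smoothPhi₃ σ y‖ ≤ |t| * saddlePhi₄ σ y := by
  set F : ℝ → ℂ := fun u => smoothPhi₃ ((σ : ℂ) + u * I) y with hF
  have hre : ∀ u : ℝ, 0 < ((σ : ℂ) + (u : ℂ) * I).re := fun u => by simp [hσ]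
  have hFd : ∀ u : ℝ, HasDerivAt F (-smoothPhi₄ ((σ : ℂ) + u * I) y * I) u := by
    intro u
    have h := HasDerivAt.comp (h₂ := fun z : ℂ => smoothPhi₃ z y) (u : ℂ) (hasDerivAt_smoothPhi₃ (hre u) y)
      (hasDerivAt_add_mul_I' σ u)
    exact h.comp_ofReal
  have hbound : ∀ u ∈ Set.uIcc 0 t, ‖-smoothPhi₄ ((σ : ℂ) + u * I) y * I‖ ≤ saddlePhi₄ σ y := by
    intro u _
    rw [norm_mul, norm_neg, Complex.norm_I, mul_one]
    exact norm_smoothPhi₄_le hσ u y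
  have h := (convex_uIcc (0 : ℝ) t).norm_image_sub_le_of_norm_hasDerivWithin_le
    (fun v _ => (hFd v).hasDerivWithinAt) hbound Set.left_mem_uIcc Set.right_mem_uIcc
  have hF0 : F 0 = smoothPhi₃ σ y := by simp [hF]
  rw [hF0, sub_zero, Real.norm_eq_abs] at h
  calc ‖smoothPhi₃ ((σ : ℂ) + t * I) y - smoothPhi₃ σ y‖ = ‖F t - smoothPhi₃ σ y‖ := rfl
    _ ≤ saddlePhi₄ σ y * |t| := h
    _ = |t| * saddlePhi₄ σ y := mul_comm _ _

end Complex

end Literature.NumberTheory.Sieve
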